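import Mathlib
import Summits.ResolutionOfSingularities.ResolutionOfSingularities.Theorems.RadicialJungCleanModelsCentreBlowup
import Literature.AlgebraicGeometry.Resolution.Principalization
import HarnessLib

/-!
# Route `RadicialJung`, crux `CleanModels` (stmt-ResolutionOfSingularities-15917), line `Sketch` rev 18, stub 4e
# `stub_cleanPrincipalization3`: CLEAN-PERMISSIBLE COSSART–PILTANT SEQUENCES and the reduction of 4e

Definitions (+ their structural API and the reduction theorem) cutting the research stub 4e «CP 2019 Prop. 4.4 KEEPING
cleanness» (lens-5 g6 STUBPLAN §7, lead memo `Cruxes/CleanModels/Lines/Sketch-memo-open-stubs.md` §1) along the landed local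
algebra L7a (`RadicialJungCleanModelsCentreBlowup.lean`, ✓ `cleanRegAt_of_isBlowup_step`):

* `CleanPermissibleAt p f G I` — the `F^p`-line of `G` is **clean-permissible at the local ring `R`** (read in `F` by `f`) **for the
  centre ideal `I ⊆ R`**: `R` is regular with a regular system of parameters `(c, w)`, `(c) = I`, and some non-trivial representative
  `Σ c_j^p G^j` is `f(u ∏ c_k^{a_k} ∏ w_m^{b_m})` with `u` a unit and SOME exponent prime to `p`, or `f u` with `ū ∉ κ(R)^p`.  This is
  VERBATIM the inline hypothesis of the landed `cleanRegAt_of_isBlowup_of_cleanPermissible` / `cleanRegAt_of_isBlowup_step` (so those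
  apply by `Iff.rfl`); at `I = 𝔪` it is implied by `CleanRegAt` (✓ `cleanPermissible_of_cleanRegAt`).
* `IsCleanRegularCentreBlowupSeq p σ J G` (inductive) — `σ : S' → S` is a Cossart–Piltant sequence for `J`
  (`IsRegularCentreBlowupSeq`: blowing ups along regular integral centres inside the non-locally-principal loci of the transforms of
  `J`) ALL OF WHOSE CENTRES ARE CLEAN-PERMISSIBLE, at each of their points, for the transform of `G` at the time they are blown up.
* `IsCleanRegularCentreBlowupSeq.isRegularCentreBlowupSeq` (forget), `IsCleanRegularCentreBlowupSeq.cleanRegAt` (**cleanness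
  propagates along such a sequence**, induction over ✓ `cleanRegAt_of_isBlowup_step`).
* `cleanPrincipalization_of_cleanPermissiblePrincipalization` — **THE REDUCTION**: if every non-zero ideal sheaf on a regular excellent
  Noetherian integral threefold carrying an everywhere-clean-regular line admits a principalizing `IsCleanRegularCentreBlowupSeq`
  («clean-permissible principalization», the research residue X_perm = lens-5 L7b + L7c), then the conclusion of the registered stub 4e
  `stub_cleanPrincipalization3` holds (its hypothesis `hT2` = 4d is not even needed).

Honest framing: OURS; X_perm is NOT in print and NOT proved here (CP 2008 Prop. 4.2/4.4 = the tree's ✓ `CossartPiltant2019Principalization_holds`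
chooses curve centres which need not be clean-permissible — witness `G = t₁`, `Y = V(t₂, t₁ - t₃²)` of the lead's memo —, and inserting the
point blow-ups that make a curve permissible creates new maximal-order curves, [CoP1] Lemma 4.3 (5), so the printed termination does not transfer
verbatim).  Nothing here proves resolution in characteristic `p` or any case of `CleanModels`.
-/

noncomputable section

set_option linter.dupNamespace false -- mandated namespace of this single-conjunct summit

open IsLocalRing CategoryTheory AlgebraicGeometry TopologicalSpace
open Literature.AlgebraicGeometry.Resolution Literature.AlgebraicGeometry.Motives

namespace Summit.ResolutionOfSingularities.ResolutionOfSingularities.Theorems.RadicialJung.CleanModels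

universe u

/-! ## Clean-permissibility of the line at a local ring for a centre ideal -/

/-- **The `F^p`-line of `G` is clean-permissible at `R` for the centre ideal `I`** (lens-5 g6 STUBPLAN §7 «M-permissible»; lead memo
§1 «Y is a coordinate axis of an r.s.p. ADAPTED to some clean presentation»): `R` is a regular local ring with a regular system of
parameters `(c, w)` (`n + l = dim R` generators of `𝔪`) such that `(c) = I`, and some non-trivial representative `Σ_j c_j^p G^j` of the
line (`c_j ∈ F`, some `c_j ≠ 0` with `j ≠ 0`) is either `f(u · ∏_k c_k^{a_k} · ∏_m w_m^{b_m})` with `u` a unit and some exponent `a_k` or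
`b_m` prime to `p` (loose clean form (1) in coordinates adapted to the centre `V(I)`; form (3) is its exponent-one case after the shift
`G ↦ G - c^p`), or `f u` with `u` a unit whose residue is not a `p`-th power (form (2)). [cite: Piltant2013, §2 Axiom 4] -/
def CleanPermissibleAt (p : ℕ) {R F : Type*} [CommRing R] [CommRing F] (f : R →+* F) (G : F) (I : Ideal R) : Prop :=
  ∃ (_ : IsRegularLocalRing R) (n l : ℕ) (c : Fin n → R) (w : Fin l → R),
    Ideal.span (Set.range (Fin.append c w)) = maximalIdeal R ∧ ringKrullDim R = ((n + l : ℕ) : WithBot ℕ∞) ∧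
    Ideal.span (Set.range c) = I ∧
    ∃ (cc : Fin p → F), (∃ j : Fin p, (j : ℕ) ≠ 0 ∧ cc j ≠ 0) ∧
      ((∃ (a : Fin n → ℕ) (b : Fin l → ℕ) (u : R), IsUnit u ∧ ((∃ k, ¬ p ∣ a k) ∨ (∃ m, ¬ p ∣ b m)) ∧
          (∑ j : Fin p, cc j ^ p * G ^ (j : ℕ)) = f (u * (∏ k, c k ^ a k) * ∏ m, w m ^ b m)) ∨
        (∃ u : R, IsUnit u ∧ (∑ j : Fin p, cc j ^ p * G ^ (j : ℕ)) = f u ∧ ∀ c' : R, u - c' ^ p ∉ maximalIdeal R))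

/-- A clean-permissible line is clean-regular there is no claim; but where the centre ideal is the maximal ideal, clean-regular
IS clean-permissible (✓ `cleanPermissible_of_cleanRegAt`, restated through the definition). [folklore] -/
theorem CleanRegAt.cleanPermissibleAt_maximalIdeal {R F : Type u} [CommRing R] [IsLocalRing R] [Field F] (p : ℕ)
    [Fact p.Prime] [CharP F p] (f : R →+* F) {G : F} (h : CleanRegAt p f G) :
    CleanPermissibleAt p f G (maximalIdeal R) :=
  cleanPermissible_of_cleanRegAt p f h

/-! ## Clean-permissible Cossart–Piltant sequences -/

open Scheme.IdealSheafData in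
/-- **`σ : S' → S` is a Cossart–Piltant sequence for `J` all of whose centres are clean-permissible for the line of `G`**: the empty
composition; or a clean-permissible sequence `σ : S' → S` followed by a blowing up `τ : S'' → S'` along the reduced (integral, regular)
closed subscheme on a closed subset `Y ⊆ S'` lying in the non-locally-principal locus of `J𝒪_{S'} = J.comap σ` (as in
`IsRegularCentreBlowupSeq.cons`) such that, moreover, the line of `σ^♯ G` is clean-permissible for `𝓘_Y` at EVERY point of `Y`.
[cite: CossartPiltant2019, Prop. 4.4 (i)] [cite: Piltant2013, §2 Axiom 4] -/
inductive IsCleanRegularCentreBlowupSeq (p : ℕ) :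
    ∀ {S' S : Scheme.{0}} [IsIntegral S'] [IsIntegral S] (σ : S' ⟶ S) [IsDominant σ], S.IdealSheafData → S.functionField → Prop
  /-- the empty sequence -/
  | nil {S : Scheme.{0}} [IsIntegral S] (J : S.IdealSheafData) (G : S.functionField) :
      IsCleanRegularCentreBlowupSeq p (𝟙 S) J G
  /-- one more blowing up along a regular integral centre in the non-principal locus, clean-permissible at each of its points -/
  | cons {S'' S' S : Scheme.{0}} [IsIntegral S''] [IsIntegral S'] [IsIntegral S] (τ : S'' ⟶ S') [IsDominant τ] (σ : S' ⟶ S)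
      [IsDominant σ] (J : S.IdealSheafData) (G : S.functionField) (Y : Closeds S') :
      IsCleanRegularCentreBlowupSeq p σ J G →
      IsIntegral (vanishingIdeal Y).subscheme →
      Scheme.IsRegular (vanishingIdeal Y).subscheme →
      (∀ y ∈ (Y : Set S'), ¬ IsLocallyPrincipalAt (J.comap σ) y) →
      IsBlowup τ (vanishingIdeal Y) →
      (∀ y ∈ (Y : Set S'), CleanPermissibleAt p (algebraMap (S'.presheaf.stalk y) S'.functionField)
        (RatFn.functionFieldMap σ G) (stalkIdeal (vanishingIdeal Y) y)) →
      IsCleanRegularCentreBlowupSeq p (τ ≫ σ) J G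

namespace IsCleanRegularCentreBlowupSeq

variable {p : ℕ}

/-- Forgetting clean-permissibility: a clean-permissible sequence is a Cossart–Piltant sequence. [folklore] -/
theorem isRegularCentreBlowupSeq {S' S : Scheme.{0}} [IsIntegral S'] [IsIntegral S] {σ : S' ⟶ S} [IsDominant σ]
    {J : S.IdealSheafData} {G : S.functionField} (h : IsCleanRegularCentreBlowupSeq p σ J G) :
    IsRegularCentreBlowupSeq σ J := by
  induction h with
  | nil J G => exact IsRegularCentreBlowupSeq.nil J
  | cons τ σ J G Y _ hint hreg hY hτ _ ih => exact IsRegularCentreBlowupSeq.cons τ σ J Y ih hint hreg hY hτ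

open Scheme.IdealSheafData in
/-- **Cleanness propagates along a clean-permissible sequence**: if the line of `G` is clean-regular at every point of `S` (function
field of characteristic `p`), then the line of `σ^♯ G` is clean-regular at every point of `S'` — induction over the sequence, each step
being ✓ `cleanRegAt_of_isBlowup_step` (over the centre: the landed local algebra of a clean-permissible centre blow-up; off the centre:
a blowing up is a local isomorphism). [cite: Piltant2013, §2 Axioms 2 (ii) and 4] -/
theorem cleanRegAt (hp : p.Prime) {S' S : Scheme.{0}} [IsIntegral S'] [IsIntegral S] {σ : S' ⟶ S} [IsDominant σ]
    {J : S.IdealSheafData} {G : S.functionField} (h : IsCleanRegularCentreBlowupSeq p σ J G) :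
    CharP S.functionField p → (∀ s : S, CleanRegAt p (algebraMap (S.presheaf.stalk s) S.functionField) G) →
      ∀ s' : S', CleanRegAt p (algebraMap (S'.presheaf.stalk s') S'.functionField) (RatFn.functionFieldMap σ G) := by
  induction h with
  | nil J G =>
    intro _ hG s
    rw [RatFn.functionFieldMap_id]
    exact hG s
  | @cons S'' S' S _ _ _ τ _ σ _ J G Y hσ hint hreg hY hτ hperm ih =>
    intro hchar hG s''
    have hchar' : CharP S'.functionField p := charP_of_injective_ringHom (RatFn.functionFieldMap σ).injective p
    have key : CleanRegAt p (algebraMap (S''.presheaf.stalk s'') S''.functionField)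
        (RatFn.functionFieldMap τ (RatFn.functionFieldMap σ G)) :=
      cleanRegAt_of_isBlowup_step (S := S') p hp hchar' (RatFn.functionFieldMap σ G) (ih hchar hG) (vanishingIdeal Y)
        (fun s hs => hperm s (by rwa [← SetLike.mem_coe, coe_support_vanishingIdeal] at hs)) τ hτ s''
    rw [RatFn.functionFieldMap_comp, RingHom.comp_apply]
    exact key

end IsCleanRegularCentreBlowupSeq

/-! ## The reduction of 4e to clean-permissible principalization -/

/-- **THE REDUCTION (stub 4e ⟸ X_perm).**  If every non-zero ideal sheaf `J` on a regular excellent Noetherian integral threefold `S`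
(function field of characteristic `p`) carrying a line which is clean-regular at every point admits a CLEAN-PERMISSIBLE principalization —
a Cossart–Piltant sequence `σ : S' → S` for `J` all of whose centres are clean-permissible when blown up, with `J𝒪_{S'}` locally principal
(the research residue X_perm: lens-5 L7b «a regular curve in the non-principal locus becomes clean-permissible after finitely many point
blow-ups» + L7c «Cossart–Piltant's principalization terminates with these insertions») —, then the conclusion of the registered stub 4e
`stub_cleanPrincipalization3` holds: `σ` principalizes `J` AND the line stays clean-regular at every point of `S'`
(`IsCleanRegularCentreBlowupSeq.cleanRegAt`). [cite: CossartPiltant2019, Prop. 4.4] [cite: Piltant2013, §2 Axiom 4] -/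
theorem cleanPrincipalization_of_cleanPermissiblePrincipalization
    (hX : ∀ (p : ℕ), p.Prime → ∀ (S : Scheme.{0}) [IsIntegral S] [IsNoetherian S],
      CharP S.functionField p → Scheme.IsRegular S → Scheme.IsExcellent S → topologicalKrullDim S = 3 →
      ∀ G : S.functionField, (∀ s : S, CleanRegAt p (algebraMap (S.presheaf.stalk s) S.functionField) G) →
      ∀ J : S.IdealSheafData, J ≠ ⊥ →
        ∃ (S' : Scheme.{0}) (σ : S' ⟶ S) (_ : IsIntegral S') (_ : IsDominant σ),
          IsCleanRegularCentreBlowupSeq p σ J G ∧ IsLocallyPrincipal (J.comap σ)) :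
    ∀ (p : ℕ), p.Prime → ∀ (S : Scheme.{0}) [IsIntegral S] [IsNoetherian S],
      CharP S.functionField p → Scheme.IsRegular S → Scheme.IsExcellent S → topologicalKrullDim S = 3 →
      ∀ G : S.functionField, (∀ s : S, CleanRegAt p (algebraMap (S.presheaf.stalk s) S.functionField) G) →
      ∀ J : S.IdealSheafData, J ≠ ⊥ →
        ∃ (S' : Scheme.{0}) (σ : S' ⟶ S) (_ : IsIntegral S') (_ : IsDominant σ),
          IsRegularCentreBlowupSeq σ J ∧ IsLocallyPrincipal (J.comap σ) ∧
          ∀ s' : S', CleanRegAt p (algebraMap (S'.presheaf.stalk s') S'.functionField) (RatFn.functionFieldMap σ G) := by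
  intro p hp S _ _ hchar hreg hexc hdim G hG J hJ
  obtain ⟨S', σ, hS', hσ, hseq, hprinc⟩ := hX p hp S hchar hreg hexc hdim G hG J hJ
  exact ⟨S', σ, hS', hσ, hseq.isRegularCentreBlowupSeq, hprinc, hseq.cleanRegAt hp hchar hG⟩

/-- **The registered stub 4e modulo X_perm**, in the stub's own shape (hypothesis `hT2` = the landed 4d `stub_cleanPointBlowup`,
not used): `X_perm → (hT2 → conclusion of stub_cleanPrincipalization3)`. [cite: CossartPiltant2019, Prop. 4.4] -/
theorem stub_cleanPrincipalization3_of_cleanPermissiblePrincipalization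
    (hX : ∀ (p : ℕ), p.Prime → ∀ (S : Scheme.{0}) [IsIntegral S] [IsNoetherian S],
      CharP S.functionField p → Scheme.IsRegular S → Scheme.IsExcellent S → topologicalKrullDim S = 3 →
      ∀ G : S.functionField, (∀ s : S, CleanRegAt p (algebraMap (S.presheaf.stalk s) S.functionField) G) →
      ∀ J : S.IdealSheafData, J ≠ ⊥ →
        ∃ (S' : Scheme.{0}) (σ : S' ⟶ S) (_ : IsIntegral S') (_ : IsDominant σ),
          IsCleanRegularCentreBlowupSeq p σ J G ∧ IsLocallyPrincipal (J.comap σ))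
    (_hT2 : ∀ (p : ℕ), p.Prime → ∀ (S : Scheme.{0}) [IsIntegral S] [IsNoetherian S], CharP S.functionField p →
    ∀ (G : S.functionField) (s : S) (hs : IsClosed ({s} : Set S)),
    CleanRegAt p (algebraMap (S.presheaf.stalk s) S.functionField) G →
    ∀ (S' : Scheme.{0}) (τ : S' ⟶ S) [IsIntegral S'] [IsDominant τ],
    IsBlowup τ (Scheme.IdealSheafData.vanishingIdeal ⟨{s}, hs⟩) →
    ∀ s' : S', τ s' = s →
    CleanRegAt p (algebraMap (S'.presheaf.stalk s') S'.functionField) (RatFn.functionFieldMap τ G)) :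
    ∀ (p : ℕ), p.Prime → ∀ (S : Scheme.{0}) [IsIntegral S] [IsNoetherian S],
      CharP S.functionField p → Scheme.IsRegular S → Scheme.IsExcellent S → topologicalKrullDim S = 3 →
      ∀ G : S.functionField, (∀ s : S, CleanRegAt p (algebraMap (S.presheaf.stalk s) S.functionField) G) →
      ∀ J : S.IdealSheafData, J ≠ ⊥ →
        ∃ (S' : Scheme.{0}) (σ : S' ⟶ S) (_ : IsIntegral S') (_ : IsDominant σ),
          IsRegularCentreBlowupSeq σ J ∧ IsLocallyPrincipal (J.comap σ) ∧
          ∀ s' : S', CleanRegAt p (algebraMap (S'.presheaf.stalk s') S'.functionField) (RatFn.functionFieldMap σ G) :=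
  fun p hp S _ _ hchar hreg hexc hdim G hG J hJ =>
    cleanPrincipalization_of_cleanPermissiblePrincipalization hX p hp S hchar hreg hexc hdim G hG J hJ

end Summit.ResolutionOfSingularities.ResolutionOfSingularities.Theorems.RadicialJung.CleanModels

end
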